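import Summits.CriticalPhenomena.SAWScalingLimit.Theses.SAWDevelopingMap
import Summits.CriticalPhenomena.SAWScalingLimit.Theses.SAWResidueField
import Summits.CriticalPhenomena.SAWScalingLimit.Cruxes.HexTight.Disproof
import Summits.CriticalPhenomena.SAWScalingLimit.Theorems.HexTight.Negative.NotRenewalGluing

/-!
# Line `reversal-virgin-disc` — LEAD'S skeleton for the crux `HexTight` (stmt-CriticalPhenomena-5423)

LEAD'S COPY (prover-line-stmt-CriticalPhenomena-5423-0, picked 2026-08-16; `work/HexTight.lean`,
re-published to `Cruxes/HexTight/Lines/reversal-virgin-disc.lean` after every reshape). Built on the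
planner's generation-2 skeleton (same six stubs, same composition). Reshapes so far:

(r1, 2026-08-16) every registered stub is stated with its signature INLINED over the line's OBJECTS
(`IsHArc`, `arcCurve`, `arcMass`, `diveMass`, `travMass`, `Straddles`, `IsVirgin`), and the (H1)-event is
written with the SAW polyline `⟨γ.walk.toCurve fun v => (δ : ℂ) * hexCenter v⟩` spelled out
(definitionally `Disproof.sawCurve γ`), so that a stub file under `Theorems/` can state EXACTLY the
registered signature after `import …Theorems.SAWDevelopingMapHexTightReversalDefs` (the objects-only Defs
module, proposed; namespace `…Theorems.HexTight.Reversal`; the block "Objects" below is byte-identical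
to its body and is replaced by that import once it lands). The named Props (`DiveRecursion`, …) are kept
as abbreviations for the composition only. Landing plan: stubs → `Theorems/SAWDevelopingMapHexTight<Stub>.lean`
(`--supports stmt-CriticalPhenomena-5423`), then this file → `Theorems/SAWDevelopingMapHexTight.lean`.

THE LINE. `HexTight` (eventual tightness of the critical hexagonal SAW laws) is, by the standing
disprover's checked §6 (`Disproof.crux_of_traversalBound`, IMPORTED: Aizenman–Burchard criterion
`isTightMeasureSet_of_traversalBounds` + the PROVED short-distance cutoff (H0)
`Disproof.not_hasTraversals_sawCurve` + the bridge `isTightAlongMesh_of_isTightMeasureSet_image`),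
exactly AB99's hypothesis (H1) for `hexSAWLaw` (`Disproof.HexTraversalBound D a b`): a power bound
`K (ρ/R)^λ`, `λ > 2`, on `k(x,ρ,R)`-fold shell traversals, `δ ≤ ρ < R ≤ 1`, eventually in `δ`.
This line supplies (H1) on INTERIOR shells (`closedBall x R ⊆ Ω`) by

* VIRGINIZATION (two-sided domain Markov + reversibility of `P ∝ x_c^{#vertices}`): conditioned
  on its pieces before the first entrance into / after the last exit from a closed ball, the
  SAW is an `x_c`-weighted self-avoiding ARC between two DOORS straddling the circle, in a
  vertex set `Λ` and edge set `H` that are ARBITRARY outside the circle and COMPLETE inside it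
  (`IsVirgin`, `Straddles`): every (H1)-event of an interior shell is an event of such an arc
  (`stub_virginization`, exact identities + the cube-root trick for the marked points, whose
  deep-endpoint case is the RADIAL arc class of `RootedShellBound`);
* the REVERSAL RECURSION (`stub_diveRecursion`, an exact weight-preserving bijection): the mass of
  arcs diving to radius `r₂` is at most `q ·` (mass of arcs diving to `r₁ ≥ r₂`), `q` the worst dive
  ratio of the class at radius `r₁` — so ONE rate-free bound `q* < 1` at aspect 2
  (`stub_oneScaleDive`) iterates to power-law one-arm decay (`BulkOneArmDecay`, milestone M1, PROVED
  here: `bulkOneArmDecay_of`), and the multi-dive charge (`stub_visitCharge`, the hard atom) upgrades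
  it to the `k₀`-fold shell bound `ArcShellBound` with `λ(k₀) → ∞`;
* the BOUNDARY regime (shells meeting `∂Ω`, frozen boundary pattern inside the ball) is NOT
  reduced by this line and is filed as its own stub (`stub_boundaryShells`).

`HexTight_of` (sorry-free) assembles: interior + boundary shell bounds ⇒ `HexTraversalBound`
(max of thresholds/constants, min of exponents/mesh bounds: `traversalBound_of_interior_of_boundary`,
proved) ⇒ the crux by `Disproof.crux_of_traversalBound`. `HexTight_skeleton` feeds it the six
registered stubs (the proof of the item modulo the stubs, primary decl `SAWDevelopingMap.HexTight`);
`HexTight_proof` is the same proposition under the checker's default decl name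
(`SAWResidueField.HexTight`, verbatim-shared).

DISPROOF USED (Cruxes/HexTight/Disproof.lean, cdisprove gen 2, imported): honours
`hexTight_false_without_endpointLimits` — the endpoint limits enter exactly twice: inside
`crux_of_traversalBound` (confinement §2b needs `a δ ∈ Ω_δ`, i.e. eventually `a δ ≠ b δ` and
reachable, `eventually_ne_and_reachable`) and in `stub_virginization` (eventual separation
`|a_δ - b_δ| ≥ |a - b|/2` makes the both-endpoints-deep case of the cube-root trick trivial); never
the refuted all-`δ` form (`not_hexTightAllMeshes`, hex twin of stmt-0772) — everything is on
`Set.Ioc 0 δ₀`; thresholds are shell-dependent and mesh bounds depend on the approximation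
(`not_hexTightUniformThreshold`, `not_hexTightFiniteNet` refute the uniform variants — not
asserted); §1 (junk regimes help) and §3d (finiteness, honest laws are probability measures) are what
`stub_virginization` leans on. Landed Negative lemma `Theorems/HexTight/Negative/NotRenewalGluing`
(`Negative.not_renewalGluingAsTyped`) is IMPORTED and respected: all gluing in this line is across
DISTINCT door mid-edges (`Straddles` forces `u ∉ Λ ∋ c`, and the recursion's two doors differ).

All sums are finite (`HexMidEdgeSAW.instFintype`); arcs use only `H`-edges (`IsHArc`), so the
dictionary with `hexSAWLaw` (walks of `hexDomainGraph Ω δ`) is exact for EVERY Jordan domain, and no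
boundary source / simple connectivity is assumed anywhere (triage r1-3 gaps (G1), (G2) do not arise).
-/

noncomputable section

open scoped BigOperators Classical ENNReal NNReal
open MeasureTheory Filter Topology Set Metric
open Literature.Probability.LatticeModels Literature.Probability.RandomPlanarGeometry
  Literature.Probability.RandomPlanarGeometry.SAW
open Summit.CriticalPhenomena.SAWScalingLimit.Cruxes.HexTight.Disproof
  (sawCurve mk_sawCurve HexTraversalBound crux_of_traversalBound)

namespace Summit.CriticalPhenomena.SAWScalingLimit.Cruxes.HexTight.ReversalVirginDisc

/-! ## Objects (byte-identical to the body of `Theorems/SAWDevelopingMapHexTightReversalDefs.lean`;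
replaced by `import` + `open …Theorems.HexTight.Reversal` once that Defs module lands) -/

variable {Λ : Finset HexVertex} {w w' : Sym2 HexVertex}

/-- The arc `γ` uses only edges of the graph `H`: consecutive visited vertices are `H`-adjacent
(in applications `H = hexDomainGraph Ω δ`; inside a virgin disc `H` contains all of `hexGraph`). -/
def IsHArc (H : SimpleGraph HexVertex) (γ : HexMidEdgeSAW Λ w w') : Prop :=
  γ.verts.IsChain H.Adj

/-- The arc as a parametrised polyline `mid(w), c(v₁), …, c(vₙ), mid(w')` in lattice units
(`HexMidEdgeSAW.points`, `polyline`). -/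
def arcCurve (γ : HexMidEdgeSAW Λ w w') : Curve ℂ := ⟨polyline γ.points⟩

/-- `Z^H_Λ(w → w')`: the `x_c`-mass `Σ x_c^{ℓ(γ)}` of the `H`-arcs of `Λ` from the mid-edge `w` to the
mid-edge `w'` (a finite sum, `HexMidEdgeSAW.instFintype`). -/
def arcMass (H : SimpleGraph HexVertex) (Λ : Finset HexVertex) (w w' : Sym2 HexVertex) : ℝ :=
  ∑ γ : HexMidEdgeSAW Λ w w', if IsHArc H γ then hexCriticalFugacity ^ γ.length else 0

/-- The `x_c`-mass of the `H`-arcs `w → w'` of `Λ` that DIVE to radius `r` about `z₀`: some visited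
vertex has its centre in the closed disc `B̄(z₀, r)`. -/
def diveMass (H : SimpleGraph HexVertex) (Λ : Finset HexVertex) (w w' : Sym2 HexVertex)
    (z₀ : ℂ) (r : ℝ) : ℝ :=
  ∑ γ : HexMidEdgeSAW Λ w w',
    if IsHArc H γ ∧ ∃ v ∈ γ.verts, dist (hexCenter v) z₀ ≤ r then
      hexCriticalFugacity ^ γ.length else 0

/-- The `x_c`-mass of the `H`-arcs `w → w'` of `Λ` whose polyline traverses the shell `D(z₀; r, R)`
by `k` separate segments (`Curve.HasTraversals`, the Aizenman–Burchard event). -/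
def travMass (H : SimpleGraph HexVertex) (Λ : Finset HexVertex) (w w' : Sym2 HexVertex)
    (k : ℕ) (z₀ : ℂ) (r R : ℝ) : ℝ :=
  ∑ γ : HexMidEdgeSAW Λ w w',
    if IsHArc H γ ∧ (arcCurve γ).HasTraversals k z₀ r R then hexCriticalFugacity ^ γ.length else 0

/-- **`w` is a DOOR of `Λ` on the circle of radius `N` about `z₀`**: `w = {u, c}` is an edge of `ℍ`
with `c ∈ Λ` in the closed disc and `u ∉ Λ` strictly outside it (so the arc's first/last vertex is
`c`). -/
def Straddles (Λ : Finset HexVertex) (z₀ : ℂ) (N : ℝ) (w : Sym2 HexVertex) : Prop :=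
  ∃ u c : HexVertex, w = s(u, c) ∧ hexGraph.Adj u c ∧ u ∉ Λ ∧ c ∈ Λ ∧
    dist (hexCenter c) z₀ ≤ N ∧ N < dist (hexCenter u) z₀

/-- **VIRGIN DISC**: the open lattice disc of radius `N` about `z₀` lies in `Λ`, and `H` contains
every edge of `ℍ` between cells of the closed `(N+1)`-disc (one lattice unit of collar; the edge
length of `ℍ` is `1/√3`). Nothing is assumed outside the disc. -/
structure IsVirgin (H : SimpleGraph HexVertex) (Λ : Finset HexVertex) (z₀ : ℂ) (N : ℝ) :
    Prop where
  /-- every cell of the open `N`-disc is a vertex of the domain -/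
  mem : ∀ v : HexVertex, dist (hexCenter v) z₀ < N → v ∈ Λ
  /-- every `ℍ`-edge between cells of the closed `(N+1)`-disc is an edge of `H` -/
  adj : ∀ v v' : HexVertex, dist (hexCenter v) z₀ ≤ N + 1 → dist (hexCenter v') z₀ ≤ N + 1 →
    hexGraph.Adj v v' → H.Adj v v'

/-! ## Named statements of the line (abbreviations used by the composition; each registered stub
below restates its statement INLINE, definitionally equal to the name) -/

/-- **REVERSAL RECURSION** (exact, provable now). In a virgin configuration at radius `N` with doors
`w, w'`, for radii `r₂ ≤ r₁ ≤ N`: if every virgin sub-configuration `(H, Λ' ⊆ Λ)` at radius `r₁`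
with doors `u, u'` has dive-to-`r₂` ratio `≤ q`, then `diveMass(r₂) ≤ q · diveMass(r₁)`. Proof: cut an
arc diving to `r₁` at its FIRST vertex `c₁` in `B̄(z₀, r₁)` (prefix `β`, door `m = {last β, c₁}` — or
`m = w` if `β = []`), cut it again at its LAST vertex `c_L` there (suffix `β'`, door
`m' = {c_L, first β'}`); the connector is an `H`-arc `m → m'` of `Λ' = Λ ∖ β ∖ β'`, which is virgin at
`r₁` (`β, β'` lie outside `B̄(z₀,r₁)`; `IsVirgin.adj` is inherited since `r₁ + 1 ≤ N + 1`), and for a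
fixed GROUP INDEX `(β, m, m', β')` the map arc ↦ connector is a length-additive bijection onto ALL
`H`-arcs `m → m'` of `Λ'` (vertex classes disjoint, `m ≠ m'`, junction edges are the group's own);
an arc dives to `r₂` iff its connector does, and every arc of the group — and every connector, which
starts at `c₁` — dives to `r₁`. Sum the hypothesis over the groups. -/
def DiveRecursion : Prop :=
  ∀ (H : SimpleGraph HexVertex) (Λ : Finset HexVertex) (z₀ : ℂ) (N r₁ r₂ q : ℝ)
    (w w' : Sym2 HexVertex),
    0 ≤ q → r₂ ≤ r₁ → r₁ ≤ N →
    IsVirgin H Λ z₀ N → Straddles Λ z₀ N w → Straddles Λ z₀ N w' →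
    (∀ (Λ' : Finset HexVertex) (u u' : Sym2 HexVertex), Λ' ⊆ Λ →
        IsVirgin H Λ' z₀ r₁ → Straddles Λ' z₀ r₁ u → Straddles Λ' z₀ r₁ u' →
        diveMass H Λ' u u' z₀ r₂ ≤ q * arcMass H Λ' u u') →
    diveMass H Λ w w' z₀ r₂ ≤ q * diveMass H Λ w w' z₀ r₁

/-- **ONE-SCALE DIVE BOUND `q* < 1`** (atom 1; open). Uniformly over virgin configurations at radius
`N ≥ N₀` (arbitrary exterior `Λ, H`; arbitrary doors `w, w'` on the circle), the arcs that dive to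
radius `N/2` carry at most the fraction `q < 1` of the arc mass. Rate-free, one aspect ratio. -/
def OneScaleDive : Prop :=
  ∃ q : ℝ, 0 ≤ q ∧ q < 1 ∧ ∃ N₀ : ℝ, ∀ (H : SimpleGraph HexVertex) (Λ : Finset HexVertex)
    (z₀ : ℂ) (N : ℝ) (w w' : Sym2 HexVertex), N₀ ≤ N →
    IsVirgin H Λ z₀ N → Straddles Λ z₀ N w → Straddles Λ z₀ N w' →
    diveMass H Λ w w' z₀ (N / 2) ≤ q * arcMass H Λ w w'

/-- **BULK ONE-ARM DECAY** (milestone M1; PROVED below from `DiveRecursion` + `OneScaleDive`). -/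
def BulkOneArmDecay : Prop :=
  ∃ q : ℝ, 0 ≤ q ∧ q < 1 ∧ ∃ N₀ : ℝ, ∀ (m : ℕ) (H : SimpleGraph HexVertex)
    (Λ : Finset HexVertex) (z₀ : ℂ) (N : ℝ) (w w' : Sym2 HexVertex), N₀ ≤ N →
    IsVirgin H Λ z₀ (2 ^ m * N) → Straddles Λ z₀ (2 ^ m * N) w →
    Straddles Λ z₀ (2 ^ m * N) w' →
    diveMass H Λ w w' z₀ N ≤ q ^ m * arcMass H Λ w w'

/-- **CHORDAL ARC SHELL BOUND** (AB99 (H1) for rim-to-rim arcs of a virgin disc, `λ(k₀) → ∞`). -/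
def ArcShellBound : Prop :=
  ∀ lam : ℝ, 0 < lam → ∃ (k₀ : ℕ) (K N₀ : ℝ), 0 ≤ K ∧ 0 < N₀ ∧
    ∀ (H : SimpleGraph HexVertex) (Λ : Finset HexVertex) (z₀ : ℂ) (n N : ℝ)
      (w w' : Sym2 HexVertex), N₀ ≤ n → 4 * n ≤ N →
      IsVirgin H Λ z₀ N → Straddles Λ z₀ N w → Straddles Λ z₀ N w' →
      travMass H Λ w w' k₀ z₀ n (N / 2) ≤ K * (n / N) ^ lam * arcMass H Λ w w'

/-- **VISIT CHARGE** (atom 2, the hard one): recursion + one-scale first-dive bound ⇒ the `k₀`-fold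
chordal shell bound. -/
def VisitCharge : Prop :=
  DiveRecursion → OneScaleDive → ArcShellBound

/-- **RADIAL (ROOTED) ARC SHELL BOUND** — the deep-endpoint case of the cube-root trick. -/
def RootedShellBound : Prop :=
  ∀ lam : ℝ, 0 < lam → ∃ (k₀ : ℕ) (K N₀ : ℝ), 0 ≤ K ∧ 0 < N₀ ∧
    ∀ (H : SimpleGraph HexVertex) (Λ : Finset HexVertex) (z₀ : ℂ) (n N : ℝ)
      (w : Sym2 HexVertex) (p q : HexVertex), N₀ ≤ n → 4 * n ≤ N →
      IsVirgin H Λ z₀ N → Straddles Λ z₀ N w → dist (hexCenter p) z₀ ≤ n → H.Adj q p →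
      travMass H (Λ.erase p) w s(q, p) k₀ z₀ n (N / 2) ≤
        K * (n / N) ^ lam * arcMass H (Λ.erase p) w s(q, p)

/-- **(H1) on INTERIOR shells** (`closedBall x R ⊆ Ω`) for the critical hexagonal SAW law; the SAW
polyline is written out (`= Disproof.sawCurve γ` by `rfl`). -/
def InteriorShellBound (D : DobrushinDomain) (a b : ℝ → HexVertex) : Prop :=
  ∃ (k : ℂ → ℝ → ℝ → ℕ) (K lam δ₀ : ℝ), 0 ≤ K ∧ 2 < lam ∧ 0 < δ₀ ∧
    ∀ δ ∈ Set.Ioc 0 δ₀, ∀ (x : ℂ) (ρ R : ℝ), δ ≤ ρ → ρ < R → R ≤ 1 →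
      Metric.closedBall x R ⊆ D.carrier →
      hexSAWLaw D.carrier δ (a δ) (b δ)
        {γ | (⟨γ.walk.toCurve fun v => (δ : ℂ) * hexCenter v⟩ : Curve ℂ).HasTraversals
          (k x ρ R) x ρ R} ≤ ENNReal.ofReal (K * (ρ / R) ^ lam)

/-- **(H1) on BOUNDARY shells** (`closedBall x R ⊄ Ω`): the regime this line does NOT reduce. -/
def BoundaryShellBound (D : DobrushinDomain) (a b : ℝ → HexVertex) : Prop :=
  ∃ (k : ℂ → ℝ → ℝ → ℕ) (K lam δ₀ : ℝ), 0 ≤ K ∧ 2 < lam ∧ 0 < δ₀ ∧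
    ∀ δ ∈ Set.Ioc 0 δ₀, ∀ (x : ℂ) (ρ R : ℝ), δ ≤ ρ → ρ < R → R ≤ 1 →
      ¬ Metric.closedBall x R ⊆ D.carrier →
      hexSAWLaw D.carrier δ (a δ) (b δ)
        {γ | (⟨γ.walk.toCurve fun v => (δ : ℂ) * hexCenter v⟩ : Curve ℂ).HasTraversals
          (k x ρ R) x ρ R} ≤ ENNReal.ofReal (K * (ρ / R) ^ lam)

/-- **VIRGINIZATION** (exact identities + bookkeeping): chordal and radial arc shell bounds ⇒ (H1) on
interior shells for every Dobrushin domain and endpoint approximation. -/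
def Virginization : Prop :=
  ArcShellBound → RootedShellBound →
    ∀ (D : DobrushinDomain) (a b : ℝ → HexVertex),
      IsEmbEndpointApprox hexGraph hexCenter D a b → InteriorShellBound D a b

/-- **BOUNDARY SHELLS** (open; NOT reduced by this line). -/
def BoundaryShells : Prop :=
  ∀ (D : DobrushinDomain) (a b : ℝ → HexVertex),
    IsEmbEndpointApprox hexGraph hexCenter D a b → BoundaryShellBound D a b

/-! ## Proved now: milestone M1 (`DiveRecursion → OneScaleDive → BulkOneArmDecay`) -/

/-- Dive mass is at most arc mass (termwise). -/
theorem diveMass_le_arcMass (H : SimpleGraph HexVertex) (Λ : Finset HexVertex)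
    (w w' : Sym2 HexVertex) (z₀ : ℂ) (r : ℝ) :
    diveMass H Λ w w' z₀ r ≤ arcMass H Λ w w' := by
  unfold diveMass arcMass
  refine Finset.sum_le_sum fun γ _ => ?_
  have hx : 0 ≤ hexCriticalFugacity ^ γ.length := pow_nonneg hexCriticalFugacity_pos_lt_one.1.le _
  by_cases hA : IsHArc H γ
  · by_cases hB : ∃ v ∈ γ.verts, dist (hexCenter v) z₀ ≤ r
    · rw [if_pos ⟨hA, hB⟩, if_pos hA]
    · rw [if_neg (fun h => hB h.2), if_pos hA]; exact hx
  · rw [if_neg (fun h => hA h.1), if_neg hA]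

/-- **Milestone M1, proved**: the reversal recursion iterated over the dyadic radii `2^j N`, with the
one-scale bound at each level, gives power-law one-arm decay in every virgin disc. -/
theorem bulkOneArmDecay_of (h₁ : DiveRecursion) (h₂ : OneScaleDive) : BulkOneArmDecay := by
  obtain ⟨q, hq0, hq1, N₀, h⟩ := h₂
  refine ⟨q, hq0, hq1, max N₀ 1, ?_⟩
  intro m
  induction m with
  | zero =>
    intro H Λ z₀ N w w' hN hV hw hw'
    simpa using diveMass_le_arcMass H Λ w w' z₀ N
  | succ m ih =>
    intro H Λ z₀ N w w' hN hV hw hw'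
    have hN0 : 0 ≤ N := le_trans (le_trans zero_le_one (le_max_right _ _)) hN
    have hN₀ : N₀ ≤ N := (le_max_left _ _).trans hN
    have h2m : (0 : ℝ) ≤ 2 ^ m := pow_nonneg (by norm_num) m
    have h2m1 : (1 : ℝ) ≤ 2 ^ m := one_le_pow₀ (by norm_num)
    have hr21 : N ≤ 2 ^ m * N := by nlinarith
    have hr1N : 2 ^ m * N ≤ 2 ^ (m + 1) * N := by rw [pow_succ]; nlinarith
    have hrec := h₁ H Λ z₀ (2 ^ (m + 1) * N) (2 ^ m * N) N (q ^ m) w w' (pow_nonneg hq0 m)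
      hr21 hr1N hV hw hw' (fun Λ' u u' _ hV' hu hu' => ih H Λ' z₀ N u u' hN hV' hu hu')
    have hone := h H Λ z₀ (2 ^ (m + 1) * N) w w' (hN₀.trans (hr21.trans hr1N)) hV hw hw'
    have hhalf : 2 ^ (m + 1) * N / 2 = 2 ^ m * N := by rw [pow_succ]; ring
    rw [hhalf] at hone
    calc diveMass H Λ w w' z₀ N ≤ q ^ m * diveMass H Λ w w' z₀ (2 ^ m * N) := hrec
      _ ≤ q ^ m * (q * arcMass H Λ w w') := mul_le_mul_of_nonneg_left hone (pow_nonneg hq0 m)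
      _ = q ^ (m + 1) * arcMass H Λ w w' := by rw [pow_succ]; ring

/-! ## Registered stubs (the six `sorry`s of this file) — signatures INLINE over the objects -/

/-- **stub 1 — REVERSAL RECURSION** (`= DiveRecursion`; exact; provable now; size M–L). -/
theorem stub_diveRecursion :
    ∀ (H : SimpleGraph HexVertex) (Λ : Finset HexVertex) (z₀ : ℂ) (N r₁ r₂ q : ℝ)
      (w w' : Sym2 HexVertex),
      0 ≤ q → r₂ ≤ r₁ → r₁ ≤ N →
      IsVirgin H Λ z₀ N → Straddles Λ z₀ N w → Straddles Λ z₀ N w' →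
      (∀ (Λ' : Finset HexVertex) (u u' : Sym2 HexVertex), Λ' ⊆ Λ →
          IsVirgin H Λ' z₀ r₁ → Straddles Λ' z₀ r₁ u → Straddles Λ' z₀ r₁ u' →
          diveMass H Λ' u u' z₀ r₂ ≤ q * arcMass H Λ' u u') →
      diveMass H Λ w w' z₀ r₂ ≤ q * diveMass H Λ w w' z₀ r₁ := by
  sorry

/-- **stub 2 — ONE-SCALE DIVE BOUND** (`= OneScaleDive`; atom 1; open; size L). -/
theorem stub_oneScaleDive :
    ∃ q : ℝ, 0 ≤ q ∧ q < 1 ∧ ∃ N₀ : ℝ, ∀ (H : SimpleGraph HexVertex) (Λ : Finset HexVertex)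
      (z₀ : ℂ) (N : ℝ) (w w' : Sym2 HexVertex), N₀ ≤ N →
      IsVirgin H Λ z₀ N → Straddles Λ z₀ N w → Straddles Λ z₀ N w' →
      diveMass H Λ w w' z₀ (N / 2) ≤ q * arcMass H Λ w w' := by
  sorry

/-- **stub 3 — VISIT CHARGE** (`= VisitCharge = DiveRecursion → OneScaleDive → ArcShellBound`; the
hard atom; open; size XL). -/
theorem stub_visitCharge :
    (∀ (H : SimpleGraph HexVertex) (Λ : Finset HexVertex) (z₀ : ℂ) (N r₁ r₂ q : ℝ)
      (w w' : Sym2 HexVertex),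
      0 ≤ q → r₂ ≤ r₁ → r₁ ≤ N →
      IsVirgin H Λ z₀ N → Straddles Λ z₀ N w → Straddles Λ z₀ N w' →
      (∀ (Λ' : Finset HexVertex) (u u' : Sym2 HexVertex), Λ' ⊆ Λ →
          IsVirgin H Λ' z₀ r₁ → Straddles Λ' z₀ r₁ u → Straddles Λ' z₀ r₁ u' →
          diveMass H Λ' u u' z₀ r₂ ≤ q * arcMass H Λ' u u') →
      diveMass H Λ w w' z₀ r₂ ≤ q * diveMass H Λ w w' z₀ r₁) →
    (∃ q : ℝ, 0 ≤ q ∧ q < 1 ∧ ∃ N₀ : ℝ, ∀ (H : SimpleGraph HexVertex) (Λ : Finset HexVertex)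
      (z₀ : ℂ) (N : ℝ) (w w' : Sym2 HexVertex), N₀ ≤ N →
      IsVirgin H Λ z₀ N → Straddles Λ z₀ N w → Straddles Λ z₀ N w' →
      diveMass H Λ w w' z₀ (N / 2) ≤ q * arcMass H Λ w w') →
    ∀ lam : ℝ, 0 < lam → ∃ (k₀ : ℕ) (K N₀ : ℝ), 0 ≤ K ∧ 0 < N₀ ∧
      ∀ (H : SimpleGraph HexVertex) (Λ : Finset HexVertex) (z₀ : ℂ) (n N : ℝ)
        (w w' : Sym2 HexVertex), N₀ ≤ n → 4 * n ≤ N →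
        IsVirgin H Λ z₀ N → Straddles Λ z₀ N w → Straddles Λ z₀ N w' →
        travMass H Λ w w' k₀ z₀ n (N / 2) ≤ K * (n / N) ^ lam * arcMass H Λ w w' := by
  sorry

/-- **stub 4 — ROOTED (RADIAL) CHARGE** (`= RootedShellBound`; atom 3; open; size L). -/
theorem stub_rootedCharge :
    ∀ lam : ℝ, 0 < lam → ∃ (k₀ : ℕ) (K N₀ : ℝ), 0 ≤ K ∧ 0 < N₀ ∧
      ∀ (H : SimpleGraph HexVertex) (Λ : Finset HexVertex) (z₀ : ℂ) (n N : ℝ)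
        (w : Sym2 HexVertex) (p q : HexVertex), N₀ ≤ n → 4 * n ≤ N →
        IsVirgin H Λ z₀ N → Straddles Λ z₀ N w → dist (hexCenter p) z₀ ≤ n → H.Adj q p →
        travMass H (Λ.erase p) w s(q, p) k₀ z₀ n (N / 2) ≤
          K * (n / N) ^ lam * arcMass H (Λ.erase p) w s(q, p) := by
  sorry

/-- **stub 5 — VIRGINIZATION** (`= Virginization`; exact identities + bookkeeping; provable now;
size L–XL). -/
theorem stub_virginization :
    (∀ lam : ℝ, 0 < lam → ∃ (k₀ : ℕ) (K N₀ : ℝ), 0 ≤ K ∧ 0 < N₀ ∧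
      ∀ (H : SimpleGraph HexVertex) (Λ : Finset HexVertex) (z₀ : ℂ) (n N : ℝ)
        (w w' : Sym2 HexVertex), N₀ ≤ n → 4 * n ≤ N →
        IsVirgin H Λ z₀ N → Straddles Λ z₀ N w → Straddles Λ z₀ N w' →
        travMass H Λ w w' k₀ z₀ n (N / 2) ≤ K * (n / N) ^ lam * arcMass H Λ w w') →
    (∀ lam : ℝ, 0 < lam → ∃ (k₀ : ℕ) (K N₀ : ℝ), 0 ≤ K ∧ 0 < N₀ ∧
      ∀ (H : SimpleGraph HexVertex) (Λ : Finset HexVertex) (z₀ : ℂ) (n N : ℝ)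
        (w : Sym2 HexVertex) (p q : HexVertex), N₀ ≤ n → 4 * n ≤ N →
        IsVirgin H Λ z₀ N → Straddles Λ z₀ N w → dist (hexCenter p) z₀ ≤ n → H.Adj q p →
        travMass H (Λ.erase p) w s(q, p) k₀ z₀ n (N / 2) ≤
          K * (n / N) ^ lam * arcMass H (Λ.erase p) w s(q, p)) →
    ∀ (D : DobrushinDomain) (a b : ℝ → HexVertex),
      IsEmbEndpointApprox hexGraph hexCenter D a b →
      ∃ (k : ℂ → ℝ → ℝ → ℕ) (K lam δ₀ : ℝ), 0 ≤ K ∧ 2 < lam ∧ 0 < δ₀ ∧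
        ∀ δ ∈ Set.Ioc 0 δ₀, ∀ (x : ℂ) (ρ R : ℝ), δ ≤ ρ → ρ < R → R ≤ 1 →
          Metric.closedBall x R ⊆ D.carrier →
          hexSAWLaw D.carrier δ (a δ) (b δ)
            {γ | (⟨γ.walk.toCurve fun v => (δ : ℂ) * hexCenter v⟩ : Curve ℂ).HasTraversals
              (k x ρ R) x ρ R} ≤ ENNReal.ofReal (K * (ρ / R) ^ lam) := by
  sorry

/-- **stub 6 — BOUNDARY SHELLS** (`= BoundaryShells`; open; size L–XL; NOT reduced by this line). -/
theorem stub_boundaryShells :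
    ∀ (D : DobrushinDomain) (a b : ℝ → HexVertex),
      IsEmbEndpointApprox hexGraph hexCenter D a b →
      ∃ (k : ℂ → ℝ → ℝ → ℕ) (K lam δ₀ : ℝ), 0 ≤ K ∧ 2 < lam ∧ 0 < δ₀ ∧
        ∀ δ ∈ Set.Ioc 0 δ₀, ∀ (x : ℂ) (ρ R : ℝ), δ ≤ ρ → ρ < R → R ≤ 1 →
          ¬ Metric.closedBall x R ⊆ D.carrier →
          hexSAWLaw D.carrier δ (a δ) (b δ)
            {γ | (⟨γ.walk.toCurve fun v => (δ : ℂ) * hexCenter v⟩ : Curve ℂ).HasTraversals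
              (k x ρ R) x ρ R} ≤ ENNReal.ofReal (K * (ρ / R) ^ lam) := by
  sorry

/-! ## The checked composition -/

/-- Interior + boundary shell bounds give AB99's (H1) for `hexSAWLaw` in `(D; a, b)`
(`Disproof.HexTraversalBound`): threshold `max k₁ k₂`, constant `max K₁ K₂`, exponent `min λ₁ λ₂`,
mesh bound `min δ₁ δ₂`. -/
theorem traversalBound_of_interior_of_boundary {D : DobrushinDomain} {a b : ℝ → HexVertex}
    (hI : InteriorShellBound D a b) (hB : BoundaryShellBound D a b) :
    HexTraversalBound D a b := by
  obtain ⟨k₁, K₁, l₁, d₁, hK₁, hl₁, hd₁, h₁⟩ := hI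
  obtain ⟨k₂, K₂, l₂, d₂, hK₂, hl₂, hd₂, h₂⟩ := hB
  refine ⟨fun x ρ R => max (k₁ x ρ R) (k₂ x ρ R), max K₁ K₂, min l₁ l₂, min d₁ d₂,
    hK₁.trans (le_max_left _ _), lt_min hl₁ hl₂, lt_min hd₁ hd₂, ?_⟩
  intro δ hδ x ρ R hδρ hρR hR1
  have hδ₁ : δ ∈ Set.Ioc 0 d₁ := ⟨hδ.1, hδ.2.trans (min_le_left _ _)⟩
  have hδ₂ : δ ∈ Set.Ioc 0 d₂ := ⟨hδ.1, hδ.2.trans (min_le_right _ _)⟩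
  have hρ : 0 < ρ := hδ.1.trans_le hδρ
  have hR : 0 < R := hρ.trans hρR
  have ht0 : 0 < ρ / R := div_pos hρ hR
  have ht1 : ρ / R ≤ 1 := (div_le_one hR).2 hρR.le
  have key : ∀ (k : ℕ) (K l : ℝ), 0 ≤ K → k ≤ max (k₁ x ρ R) (k₂ x ρ R) → K ≤ max K₁ K₂ →
      min l₁ l₂ ≤ l →
      hexSAWLaw D.carrier δ (a δ) (b δ) {γ | (sawCurve γ).HasTraversals k x ρ R} ≤
        ENNReal.ofReal (K * (ρ / R) ^ l) →
      hexSAWLaw D.carrier δ (a δ) (b δ)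
          {γ | (sawCurve γ).HasTraversals (max (k₁ x ρ R) (k₂ x ρ R)) x ρ R} ≤
        ENNReal.ofReal (max K₁ K₂ * (ρ / R) ^ min l₁ l₂) := by
    intro k K l hK0 hk hK hl hP
    refine le_trans (measure_mono fun γ hγ => ?_) (hP.trans (ENNReal.ofReal_le_ofReal ?_))
    · exact Curve.HasTraversals.of_le hγ hk
    · have hpow : (ρ / R) ^ l ≤ (ρ / R) ^ min l₁ l₂ :=
        Real.rpow_le_rpow_of_exponent_ge ht0 ht1 hl
      calc K * (ρ / R) ^ l ≤ K * (ρ / R) ^ min l₁ l₂ := mul_le_mul_of_nonneg_left hpow hK0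
        _ ≤ max K₁ K₂ * (ρ / R) ^ min l₁ l₂ :=
          mul_le_mul_of_nonneg_right hK (Real.rpow_nonneg ht0.le _)
  by_cases hin : closedBall x R ⊆ D.carrier
  · exact key _ _ _ hK₁ (le_max_left _ _) (le_max_left _ _) (min_le_left _ _)
      (h₁ δ hδ₁ x ρ R hδρ hρR hR1 hin)
  · exact key _ _ _ hK₂ (le_max_right _ _) (le_max_right _ _) (min_le_right _ _)
      (h₂ δ hδ₂ x ρ R hδρ hρR hR1 hin)

/-- **The line concludes the crux** (`<Crux>_of`, sorry-free, every hypothesis a named stub statement). -/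
theorem HexTight_of :
    DiveRecursion → OneScaleDive → VisitCharge → RootedShellBound → Virginization →
    BoundaryShells → Summit.CriticalPhenomena.SAWScalingLimit.Theses.SAWDevelopingMap.HexTight :=
  fun h₁ h₂ h₃ h₄ h₅ h₆ =>
    crux_of_traversalBound fun D a b hab =>
      traversalBound_of_interior_of_boundary (h₅ (h₃ h₁ h₂) h₄ D a b hab) (h₆ D a b hab)

/-- The same, fed with the registered stubs (sorries only inside `stub_*`): the proof of the item
modulo the six stubs, under the PRIMARY route's decl name. -/
theorem HexTight_skeleton :
    Summit.CriticalPhenomena.SAWScalingLimit.Theses.SAWDevelopingMap.HexTight :=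
  HexTight_of stub_diveRecursion stub_oneScaleDive stub_visitCharge stub_rootedCharge
    stub_virginization stub_boundaryShells

/-- Skeleton-checker entry point: the crux under its ledger-default decl name (route `SAWResidueField`;
the decl is shared VERBATIM with `SAWDevelopingMap.HexTight`). -/
theorem HexTight_proof :
    Summit.CriticalPhenomena.SAWScalingLimit.Theses.SAWResidueField.HexTight :=
  fun D a b hab => HexTight_skeleton D a b hab

end Summit.CriticalPhenomena.SAWScalingLimit.Cruxes.HexTight.ReversalVirginDisc

end
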